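import Summits.NavierStokesRegularity.NavierStokesRegularity.Theorems.TerminalTraceTypeITraceScarL3LogMeanApexAECloser
import Summits.NavierStokesRegularity.NavierStokesRegularity.Theorems.TerminalTraceTypeITraceScarL3SqrtTwoApexWindow
import Summits.NavierStokesRegularity.NavierStokesRegularity.Theorems.TerminalTraceTypeITraceScarL3LogMeanApexConsequences
import Summits.NavierStokesRegularity.NavierStokesRegularity.Theorems.TerminalTraceTypeITraceScarL3ApexPackageTranslate
import HarnessLib

/-!
# T28-B from an ALMOST-EVERYWHERE rate with log-mean `q < 1`: NO top singular point (T28-C storey (B1), the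
# form the zoom delivers; ROUND-28 §3; item `TerminalTrace.TypeITraceScarL3`, stmt-NavierStokesRegularity-18385)

Seat nsreg-C26-p1 g2 (cell ns-regularity-ideate), `--supports stmt-NavierStokesRegularity-18385` (helper);
planner-of-record nsreg-p2 g29 (ROUND-28 §3 T28-B/C; DIRECTOR-NS #130 (2)).  The a.e. twin of
`no_topSingular_of_logMean_lt_one` (`…LogMeanApexConsequences`), from `one_le_logMean_of_quietShell_of_aeRate`
(`…LogMeanApexAECloser`):

* **`no_topSingular_of_aeLogMean_lt_one`** — an extinct Type-I apex package of class `(M, D₀, C)` (ANY `C`)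
  with an a.e. rate `‖U(s, y)‖ ≤ β(s)` on a final slab `]T,0[ × ℝ³` whose window `lintegral`s obey
  `∫⁻_{]s',s[} β² ≤ 2q·log((−s')/(−s)) + K₀` (`T < s' ≤ s < 0`) with `q < 1` has NO backward-singular point on
  the top slice — nothing is asked of `β` (no continuity, no measurability).  Proof = R27 §4 verbatim with the
  a.e. threshold: translates keep the package (`apexPackage_translate`) and the a.e. rate (`ae_rate_translate`;
  the (LM_q) datum is purely temporal), quiet shells about a putative singular `x` of every ratio are excluded,
  so every closed shell about `x` meets the closed top singular set, whence `μH[1] Σ₀ ≠ 0` by the sphere trick —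
  against CKN at the top.
* `topSingularSet_eq_empty_of_aeLogMean_lt_one` — the same as set emptiness.

This is the package-level half of T28-C: storey (B2) (the zoom: `‖U‖ ≤ limsup_j β_j` a.e. by `L³_loc`
subsequences, (LM_q) by reverse Fatou under the Type-I envelope) delivers exactly these hypotheses.
WHAT THIS IS NOT: not the zoom, not Stub LOUD for all packages, NOT a proof of Navier–Stokes regularity.
[folklore; Ghidaglia 1986; Agmon–Nirenberg 1967; CaffarelliKohnNirenberg1982 Thm B; Seregin2014 Prop. 6.20]
-/

noncomputable section

set_option linter.dupNamespace false

namespace Summit.NavierStokesRegularity.NavierStokesRegularity.Theorems.TypeITraceScarL3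

open MeasureTheory Set Function Filter Topology Metric InnerProductSpace
open Literature.Analysis Literature.Analysis.FluidPDE
open scoped NNReal ENNReal RealInnerProductSpace ContDiff

/-- **No top singular point for an extinct Type-I apex package with an a.e. rate of log-mean `q < 1`**
(module docstring; nothing is asked of `β`). [folklore; Ghidaglia 1986; Agmon–Nirenberg 1967;
CaffarelliKohnNirenberg1982 Thm B] -/
theorem no_topSingular_of_aeLogMean_lt_one {M D₀ : ℝ≥0} {C : ℝ}
    {U : ℝ → EuclideanSpace ℝ (Fin 3) → EuclideanSpace ℝ (Fin 3)}
    {P : ℝ → EuclideanSpace ℝ (Fin 3) → ℝ}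
    {G : ℝ → EuclideanSpace ℝ (Fin 3) → EuclideanSpace ℝ (Fin 3) →L[ℝ] EuclideanSpace ℝ (Fin 3)}
    (hsw : ∀ a : ℝ, 0 < a →
      IsSuitableWeakSolutionInBall a (0 : ℝ × EuclideanSpace ℝ (Fin 3)) U P)
    (hG : ∀ a : ℝ, 0 < a →
      HasWeakSpatialGradientOn
        (parabolicCylinderOpens a (0 : ℝ × EuclideanSpace ℝ (Fin 3))) U G)
    (hI : ∀ a : ℝ, 0 < a →
      typeIBound (parabolicCylinder a (0 : ℝ × EuclideanSpace ℝ (Fin 3))) U P G ≤ M)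
    (hD : ∀ z₀ : ℝ × EuclideanSpace ℝ (Fin 3), z₀.1 ≤ 0 →
      ∀ r : ℝ, 0 < r → cknD r z₀ P ≤ D₀)
    (hrate : ∀ s : ℝ, s < 0 →
      ∀ᵐ y : EuclideanSpace ℝ (Fin 3), ‖U s y‖ ≤ C / Real.sqrt (-s))
    (htop : ∀ φ : EuclideanSpace ℝ (Fin 3) → EuclideanSpace ℝ (Fin 3),
      ContDiff ℝ (⊤ : ℕ∞) φ →
      HasCompactSupport φ → ∀ ε : ℝ, 0 < ε →
      ∃ s₀ : ℝ, s₀ < 0 ∧ ∀ᵐ s ∂(volume.restrict (Ioo s₀ 0)), |∫ y, ⟪U s y, φ y⟫| ≤ ε)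
    {T : ℝ} {β : ℝ → ℝ} {q K₀ : ℝ} (hT : T < 0) (hK₀ : 0 ≤ K₀)
    (hβU : ∀ᵐ z ∂(volume.restrict (Ioo T 0 ×ˢ (univ : Set (EuclideanSpace ℝ (Fin 3))))),
      ‖U z.1 z.2‖ ≤ β z.1)
    (hLM : ∀ s' ∈ Ioo T 0, ∀ s ∈ Ioo T 0, s' ≤ s →
      ∫⁻ σ in Ioo s' s, ENNReal.ofReal (β σ ^ 2) ≤ ENNReal.ofReal (2 * q * Real.log ((-s') / (-s)) + K₀))
    (hq : q < 1) :
    ∀ x : EuclideanSpace ℝ (Fin 3), ¬ IsBackwardSingularPoint U ((0 : ℝ), x) := by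
  intro x hx
  -- every closed shell about `x`, of every ratio, meets the (closed) top singular set
  have hmeet : ∀ R : ℝ, 0 < R → R < 1 → ∀ A : ℝ, 1 < A →
      ∃ y ∈ {y : EuclideanSpace ℝ (Fin 3) | IsBackwardSingularPoint U ((0 : ℝ), y)},
        R ≤ ‖y - x‖ ∧ ‖y - x‖ ≤ A * R := by
    intro R hR _ A hA
    by_contra hno
    simp only [not_exists, not_and, mem_setOf_eq] at hno
    -- every point of the closed shell about the origin is regular for the translate
    have hreg : ∀ y : EuclideanSpace ℝ (Fin 3), R ≤ ‖y‖ → ‖y‖ ≤ A * R →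
        ¬ IsBackwardSingularPoint (fun s y => U s (y + x)) ((0 : ℝ), y) := by
      intro y h1 h2 hy
      rw [isBackwardSingularPoint_translate_iff] at hy
      have e : ‖y + x - x‖ = ‖y‖ := by rw [add_sub_cancel_right]
      exact hno (y + x) hy (by rw [e]; exact h1) (by rw [e]; exact h2)
    obtain ⟨hsw', hG', hI', hD', hrate', htop'⟩ := apexPackage_translate x hsw hG hI hD hrate htop
    obtain ⟨δ, hδ, R', hR', K, hquiet⟩ := quietShell_of_forall_not_isBackwardSingularPoint hR hA hreg
    have hsing' : IsBackwardSingularPoint (fun s y => U s (y + x)) (0 : ℝ × EuclideanSpace ℝ (Fin 3)) :=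
      (isBackwardSingularPoint_translate_zero_iff x U).2 hx
    have h1 := one_le_logMean_of_quietShell_of_aeRate M D₀ C _ _ _ hsw' hG' hI' hD' hrate' htop' hsing' A R'
      δ K hA hR' hδ hquiet T β q K₀ hT hK₀ (ae_rate_translate x hβU) hLM
    linarith
  exact hausdorffMeasure_ne_zero_of_meets_every_shell (isClosed_topSingularSet U) x hmeet
    (hausdorffMeasure_topSingular_apex_eq_zero hsw)

/-- **The top singular set of an extinct Type-I apex package with an a.e. rate of log-mean `q < 1` is EMPTY**
— in particular such a package is not backward singular at the origin (LOUD stub / Stub C for it).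
[folklore; CaffarelliKohnNirenberg1982 Thm B] -/
theorem topSingularSet_eq_empty_of_aeLogMean_lt_one {M D₀ : ℝ≥0} {C : ℝ}
    {U : ℝ → EuclideanSpace ℝ (Fin 3) → EuclideanSpace ℝ (Fin 3)}
    {P : ℝ → EuclideanSpace ℝ (Fin 3) → ℝ}
    {G : ℝ → EuclideanSpace ℝ (Fin 3) → EuclideanSpace ℝ (Fin 3) →L[ℝ] EuclideanSpace ℝ (Fin 3)}
    (hsw : ∀ a : ℝ, 0 < a →
      IsSuitableWeakSolutionInBall a (0 : ℝ × EuclideanSpace ℝ (Fin 3)) U P)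
    (hG : ∀ a : ℝ, 0 < a →
      HasWeakSpatialGradientOn
        (parabolicCylinderOpens a (0 : ℝ × EuclideanSpace ℝ (Fin 3))) U G)
    (hI : ∀ a : ℝ, 0 < a →
      typeIBound (parabolicCylinder a (0 : ℝ × EuclideanSpace ℝ (Fin 3))) U P G ≤ M)
    (hD : ∀ z₀ : ℝ × EuclideanSpace ℝ (Fin 3), z₀.1 ≤ 0 →
      ∀ r : ℝ, 0 < r → cknD r z₀ P ≤ D₀)
    (hrate : ∀ s : ℝ, s < 0 →
      ∀ᵐ y : EuclideanSpace ℝ (Fin 3), ‖U s y‖ ≤ C / Real.sqrt (-s))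
    (htop : ∀ φ : EuclideanSpace ℝ (Fin 3) → EuclideanSpace ℝ (Fin 3),
      ContDiff ℝ (⊤ : ℕ∞) φ →
      HasCompactSupport φ → ∀ ε : ℝ, 0 < ε →
      ∃ s₀ : ℝ, s₀ < 0 ∧ ∀ᵐ s ∂(volume.restrict (Ioo s₀ 0)), |∫ y, ⟪U s y, φ y⟫| ≤ ε)
    {T : ℝ} {β : ℝ → ℝ} {q K₀ : ℝ} (hT : T < 0) (hK₀ : 0 ≤ K₀)
    (hβU : ∀ᵐ z ∂(volume.restrict (Ioo T 0 ×ˢ (univ : Set (EuclideanSpace ℝ (Fin 3))))),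
      ‖U z.1 z.2‖ ≤ β z.1)
    (hLM : ∀ s' ∈ Ioo T 0, ∀ s ∈ Ioo T 0, s' ≤ s →
      ∫⁻ σ in Ioo s' s, ENNReal.ofReal (β σ ^ 2) ≤ ENNReal.ofReal (2 * q * Real.log ((-s') / (-s)) + K₀))
    (hq : q < 1) :
    {x : EuclideanSpace ℝ (Fin 3) | IsBackwardSingularPoint U ((0 : ℝ), x)} = ∅ :=
  Set.eq_empty_of_forall_notMem fun x hx =>
    no_topSingular_of_aeLogMean_lt_one hsw hG hI hD hrate htop hT hK₀ hβU hLM hq x hx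

end Summit.NavierStokesRegularity.NavierStokesRegularity.Theorems.TypeITraceScarL3

end
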